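import Literature.NumberTheory.GaloisCohomology.KolyvaginSystemsDivisibility
import HarnessLib

/-!
# Change of `𝒫` and the shifted Kolyvagin system `κ^{(n)}` (Mazur–Rubin 2004 Remark 3.1.4, Example 3.1.12), with the `∂`-inequality used in Prop. 4.5.8

Topic `NumberTheory/GaloisCohomology`; namespace `Literature.NumberTheory.GaloisCohomology`
(extending `KolyvaginDatum` of `KolyvaginSystems.lean`).  DEFINITIONS WITH BODIES AND PROVED
THEOREMS ONLY: no named fact is introduced (D-0026).  Cell `bsd-addord` (FULL-BSD rank ≤ 1
programme, D-0033 tranche 1a), literature seat; companion of `KolyvaginSystemsDivisibility.lean`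
(definition request D1 of the route prep `KimAtThreeKolyvagin`, W2).  The memo
`run/shared/lean/pub/bsd-addord/kim3/KIM3-PROOF.md` §3.4 P7 runs Mazur–Rubin's Prop. 4.5.8 at `p = 3`
by "induction over `(T_k, 𝓕(ℓ), 𝒫_j − {ℓ})`", i.e. through the SHIFTED Kolyvagin system of
Example 3.1.12; this file types that construction in the tree's generator-fixed, finite-level
currency (no `⊗ G_n`, `I_n = 0`: `KolyvaginSystems.lean`, Design notes) and PROVES the two
structural facts print calls "natural" / "straightforward", plus the one-line inequality of the
proof of Prop. 4.5.8.

## Sources, verbatim (authors' PDF of [MazurRubin2004], pp. 20, 22–23, 50)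

* Remark 3.1.4 (p. 20): "The assignments `(T,𝓕,𝒫) ↦ 𝓗(T,𝓕,𝒫)`, `(T,𝓕,𝒫) ↦ KS(T,𝓕,𝒫)` have the
  following functorial properties … • Change of `𝒫`: If `𝒫′ ⊂ 𝒫` then `𝓗_{T,𝒫′}` is the restriction
  of `𝓗_{T,𝒫}` to the subgraph `𝒳(𝒫′) ⊂ 𝒳(𝒫)`, and there is a natural map `KS(T,𝒫) → KS(T,𝒫′)`."
* Example 3.1.12 (pp. 22–23): "Suppose `κ ∈ KS(T,𝓕,𝒫)` and `n ∈ 𝒩`. Let `𝒫(n)` be the set of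
  primes in `𝒫` not dividing `n`. If `ξ ∈ Hom(G_n, R/I_n)` then the collection `κ^{(n)}` defined by
  `κ^{(n)}_m = κ_{nm} ⊗ ξ` for `m ∈ 𝒩` prime to `n` is a Kolyvagin system for `(T/I_nT, 𝓕(n), 𝒫(n))`.
  (We view `⊗ξ` here as a map from `G_{nm} ⊗ (R/I_n) = G_m ⊗ G_n ⊗ (R/I_n)` to `G_m ⊗ (R/I_n)` for
  every `m`.) This construction defines a homomorphism `KS(T,𝓕,𝒫) ⊗ Hom(G_n, R/I_n) →
  KS(T/I_nT, 𝓕(n), 𝒫(n))`."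
* Proof of Prop. 4.5.8 (p. 50): "Let `κ^{(ℓ)} ∈ KS(T, 𝓕(ℓ), 𝒫 − {ℓ})` be the Kolyvagin system defined
  in Example 3.1.12, which is obtained by setting `κ^{(ℓ)}_n = κ_{nℓ} ⊗ ξ` for some generator `ξ` of
  `Hom(G_ℓ, R)`. We have `∂^{(r)}(κ) ≥ ∂^{(r−1)}(κ^{(ℓ)}) = min{k, j + Σ_{i>r−1} d_{i+1}}`. where the
  inequality is clear from the definition and the equality follows from our induction hypothesis
  applied to `κ^{(ℓ)}`."  READING (this file, `kolyvaginPartial_le_kolyvaginPartial_shift`): the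
  levels `mℓ` (`ν(m) = r−1`, `ℓ ∤ m`) over which `∂^{(r−1)}(κ^{(ℓ)})` minimises are among the levels
  `n` with `ν(n) = r` over which `∂^{(r)}(κ)` minimises, with the same terms `k − length(Rκ_{mℓ})`,
  so the definition gives `∂^{(r)}(κ) ≤ ∂^{(r−1)}(κ^{(ℓ)})` — which is the direction the proof USES
  ("We will prove the opposite inequality [`∂^{(r)}(κ) ≤ min{k, j + Σ_{i>r} d_i}`] by induction on
  `r`"); the printed "`≥`" in that display is a misprint for "`≤`" (located misprint, recorded here;
  no statement of [MazurRubin2004] is affected).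

## What is here

* `SelmerStructure.transverseAt_transverseAt` (PROVED): `(𝓕(c))(d) = 𝓕(c ∪ d)` — iterating the
  transverse modification [Sakamoto Def. 3.3; Mazur–Rubin `𝓕(n)`].
* `KolyvaginDatum.restrictPrimes D 𝒫′` (change of `𝒫`, Remark 3.1.4), `KolyvaginDatum.restrictSystem`
  (`κ` restricted to `𝒩(𝒫′)`, extended by zero) and `IsKolyvaginSystem.restrictSystem` (PROVED: the
  "natural map `KS(T,𝒫) → KS(T,𝒫′)`").
* `KolyvaginDatum.awayFrom D n` (the datum with primes `𝒫(n) = 𝒫 ∖ n`), `KolyvaginDatum.shift κ n`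
  (`κ^{(n)}_m := κ_{n ∪ m}` for `m` disjoint from `n`, zero otherwise) and `IsKolyvaginSystem.shift`
  (PROVED: Example 3.1.12, "`κ^{(n)}` is a Kolyvagin system for `(T, 𝓕(n), 𝒫(n))`"), with
  `shift_mem_kolyvaginSystems`.
* `KolyvaginDatum.kolyvaginPartial_le_kolyvaginPartial_shift` (PROVED): for `ℓ ∈ 𝒫`,
  `∂^{(r+1)}(κ) ≤ ∂^{(r)}(κ^{(ℓ)})` (the inequality of the proof of Prop. 4.5.8), and
  `kolyvaginPartialInfty_le_kolyvaginPartialInfty_shift`: `∂^{(∞)}(κ) ≤ ∂^{(∞)}(κ^{(ℓ)})`.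

Not here: the tensor factor `⊗ξ` (absorbed by the generator-fixed convention — Kim, AJM 148 §2.2.2,
as in `KolyvaginSystems.lean`); `T/I_nT` for `I_n ≠ 0` (finite level, `𝒫 ⊂ 𝒫_k`, so `I_n = 0`,
Mazur–Rubin p. 35); Prop. 4.5.8 / Thm. 4.5.9 themselves (not asserted).

## References

* [MazurRubin2004] B. Mazur, K. Rubin, *Kolyvagin systems*, Mem. Amer. Math. Soc. 168 (2004), no.
  799: Remark 3.1.4 (p. 20), Example 3.1.12 (pp. 22–23), Def. 4.5.7 (p. 49), proof of Prop. 4.5.8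
  (p. 50) — read (authors' PDF, `run/shared/lean/pub/bsd-addord/lit/mazurrubin2004/txt-authors-pdf/`).
* [Sakamoto2024] R. Sakamoto, J. Théor. Nombres Bordeaux 36 (2024), Def. 3.3 (p. 922), Def. 4.1
  (p. 926) — read.
* [Kim2022StructureSelmer] C.-H. Kim, Amer. J. Math. 148 (2026), §2.2.2 (generator-fixed convention).
-/

noncomputable section

open Function NumberField IsDedekindDomain Field
open scoped NumberField ContRepresentation Classical

universe u

/-! ## A. Iterating the transverse modification: `(𝓕(c))(d) = 𝓕(c ∪ d)` -/

namespace Literature.NumberTheory.GaloisRepresentations.DiscreteGaloisModule.SelmerStructure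

variable {K : Type u} [Field K] [NumberField K] {M : Type u} [AddCommGroup M] [TopologicalSpace M]
  [DiscreteTopology M] {ρ : DiscreteGaloisModule K M}

/-- Putting the transverse conditions first at the places of `c` and then at the places of `d` is
putting them at the places of `c ∪ d`: `(𝓕(c))(d) = 𝓕(c ∪ d)` — the bookkeeping behind
Mazur–Rubin's `𝓕(nℓ) = (𝓕(ℓ))(n)` in Example 3.1.12.  PROVED (case analysis on the place).
[cite: Sakamoto2024, Def. 3.3 (p. 922)] -/
theorem transverseAt_transverseAt (𝓕 𝒯 : SelmerStructure ρ)
    (c d : Finset (HeightOneSpectrum (𝓞 K))) :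
    (𝓕.transverseAt 𝒯 c).transverseAt 𝒯 d = 𝓕.transverseAt 𝒯 (c ∪ d) := by
  funext v
  cases v with
  | inl w => rfl
  | inr q =>
    by_cases hd : q ∈ d
    · simp [hd]
    · by_cases hc : q ∈ c
      · simp [hd, hc]
      · simp [hd, hc]

end Literature.NumberTheory.GaloisRepresentations.DiscreteGaloisModule.SelmerStructure

namespace Literature.NumberTheory.GaloisCohomology

open Literature.NumberTheory.GaloisRepresentations
open Literature.NumberTheory.GaloisRepresentations.DiscreteGaloisModule (SelmerStructure)

namespace KolyvaginDatum

variable {K : Type u} [Field K] [NumberField K]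
  {M : Type u} [AddCommGroup M] [TopologicalSpace M] [DiscreteTopology M]
  {ρ : DiscreteGaloisModule K M}

/-! ## B. Change of `𝒫` (Mazur–Rubin Remark 3.1.4) -/

/-- **Change of `𝒫`**: the same transverse conditions and comparison maps, with the Kolyvagin primes
cut down to `𝒫 ∩ 𝒫′` (Mazur–Rubin Remark 3.1.4, "If `𝒫′ ⊂ 𝒫` then `𝓗_{T,𝒫′}` is the restriction of
`𝓗_{T,𝒫}` to the subgraph `𝒳(𝒫′) ⊂ 𝒳(𝒫)`"; intersecting rather than assuming `𝒫′ ⊂ 𝒫`).  Used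
with `𝒫′ = 𝒫_j` ("By restricting to `𝒫 ∩ 𝒫_k` …", p. 35; Cor. 4.5.2 (iv)).
[cite: MazurRubin2004, Remark 3.1.4 (p. 20)] -/
def restrictPrimes (D : KolyvaginDatum ρ) (P' : Set (HeightOneSpectrum (𝓞 K))) :
    KolyvaginDatum ρ where
  primes := D.primes ∩ P'
  transverse := D.transverse
  fs := D.fs

/-- The primes of the restricted datum. [cite: MazurRubin2004, Remark 3.1.4 (p. 20)] -/
@[simp] theorem restrictPrimes_primes (D : KolyvaginDatum ρ) (P' : Set (HeightOneSpectrum (𝓞 K))) :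
    (D.restrictPrimes P').primes = D.primes ∩ P' := rfl

/-- Levels of the restricted datum are the levels of `D` contained in `𝒫′` (`𝒩(𝒫 ∩ 𝒫′)`).
[cite: MazurRubin2004, Remark 3.1.4 (p. 20)] -/
theorem isLevel_restrictPrimes_iff (D : KolyvaginDatum ρ) (P' : Set (HeightOneSpectrum (𝓞 K)))
    (d : Finset (HeightOneSpectrum (𝓞 K))) :
    (D.restrictPrimes P').IsLevel d ↔ D.IsLevel d ∧ ↑d ⊆ P' :=
  Set.subset_inter_iff

/-- The level structures do not change under change of `𝒫` (same transverse conditions).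
[cite: MazurRubin2004, Remark 3.1.4 (p. 20)] -/
@[simp] theorem atLevel_restrictPrimes (D : KolyvaginDatum ρ) (P' : Set (HeightOneSpectrum (𝓞 K)))
    (𝓕 : SelmerStructure ρ) (d : Finset (HeightOneSpectrum (𝓞 K))) :
    (D.restrictPrimes P').atLevel 𝓕 d = D.atLevel 𝓕 d := rfl

/-- **The natural map `KS(T, 𝒫) → KS(T, 𝒫′)`** on the level of functions: keep `κ_n` on the levels of
`𝒩(𝒫 ∩ 𝒫′)` and put `0` elsewhere (the tree's Kolyvagin systems are functions on all finite sets
of places vanishing off the levels).  [cite: MazurRubin2004, Remark 3.1.4 (p. 20)] -/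
def restrictSystem (D : KolyvaginDatum ρ) (P' : Set (HeightOneSpectrum (𝓞 K)))
    (κ : Finset (HeightOneSpectrum (𝓞 K)) → galoisCohomology ρ 1) :
    Finset (HeightOneSpectrum (𝓞 K)) → galoisCohomology ρ 1 :=
  fun d => if (D.restrictPrimes P').IsLevel d then κ d else 0

/-- On the levels of `𝒩(𝒫 ∩ 𝒫′)` the restricted system is `κ`. [cite: MazurRubin2004, Remark 3.1.4 (p. 20)] -/
theorem restrictSystem_apply_of_isLevel (D : KolyvaginDatum ρ) (P' : Set (HeightOneSpectrum (𝓞 K)))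
    (κ : Finset (HeightOneSpectrum (𝓞 K)) → galoisCohomology ρ 1)
    {d : Finset (HeightOneSpectrum (𝓞 K))} (hd : (D.restrictPrimes P').IsLevel d) :
    D.restrictSystem P' κ d = κ d := by
  simp [restrictSystem, hd]

/-- Off the levels of `𝒩(𝒫 ∩ 𝒫′)` the restricted system is `0`. [cite: MazurRubin2004, Remark 3.1.4 (p. 20)] -/
theorem restrictSystem_apply_of_not_isLevel (D : KolyvaginDatum ρ)
    (P' : Set (HeightOneSpectrum (𝓞 K)))
    (κ : Finset (HeightOneSpectrum (𝓞 K)) → galoisCohomology ρ 1)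
    {d : Finset (HeightOneSpectrum (𝓞 K))} (hd : ¬ (D.restrictPrimes P').IsLevel d) :
    D.restrictSystem P' κ d = 0 := by
  simp [restrictSystem, hd]

/-- **Change of `𝒫` maps Kolyvagin systems to Kolyvagin systems** (Mazur–Rubin Remark 3.1.4: "there
is a natural map `KS(T,𝒫) → KS(T,𝒫′)`").  PROVED from the three defining conditions.
[cite: MazurRubin2004, Remark 3.1.4 (p. 20)] -/
theorem IsKolyvaginSystem.restrictSystem {D : KolyvaginDatum ρ} {𝓕 : SelmerStructure ρ}
    {κ : Finset (HeightOneSpectrum (𝓞 K)) → galoisCohomology ρ 1} (hκ : D.IsKolyvaginSystem 𝓕 κ)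
    (P' : Set (HeightOneSpectrum (𝓞 K))) :
    (D.restrictPrimes P').IsKolyvaginSystem 𝓕 (D.restrictSystem P' κ) where
  eq_zero_of_not_isLevel d hd := D.restrictSystem_apply_of_not_isLevel P' κ hd
  mem_selmerGroup d hd := by
    rw [D.restrictSystem_apply_of_isLevel P' κ hd, atLevel_restrictPrimes]
    exact hκ.mem_selmerGroup d ((D.isLevel_restrictPrimes_iff P' d).mp hd).1
  fs_rel d hd q hq hqd := by
    have hd' := (D.isLevel_restrictPrimes_iff P' d).mp hd
    have hq' : q ∈ D.primes ∧ q ∈ P' := hq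
    have hqd' : (D.restrictPrimes P').IsLevel (insert q d) := hd.insert hq
    rw [D.restrictSystem_apply_of_isLevel P' κ hqd', D.restrictSystem_apply_of_isLevel P' κ hd]
    exact hκ.fs_rel d hd'.1 q hq'.1 hqd

/-- The restricted system lies in `KS₁(T, 𝓕)` for the restricted datum.
[cite: MazurRubin2004, Remark 3.1.4 (p. 20)] -/
theorem restrictSystem_mem_kolyvaginSystems {D : KolyvaginDatum ρ} {𝓕 : SelmerStructure ρ}
    (P' : Set (HeightOneSpectrum (𝓞 K))) (κ : D.kolyvaginSystems 𝓕) :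
    D.restrictSystem P' κ.1 ∈ (D.restrictPrimes P').kolyvaginSystems 𝓕 :=
  ((D.mem_kolyvaginSystems_iff 𝓕 κ.1).mp κ.2).restrictSystem P'

/-! ## C. The shifted system `κ^{(n)}` (Mazur–Rubin Example 3.1.12) -/

/-- **The datum `(T, ·, 𝒫(n))` away from `n`**: "Let `𝒫(n)` be the set of primes in `𝒫` not dividing
`n`" (Mazur–Rubin Example 3.1.12) — the Kolyvagin primes outside the finite set `n`, the same
transverse conditions and comparison maps.  [cite: MazurRubin2004, Example 3.1.12 (p. 22)] -/
def awayFrom (D : KolyvaginDatum ρ) (n : Finset (HeightOneSpectrum (𝓞 K))) : KolyvaginDatum ρ :=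
  D.restrictPrimes (↑n)ᶜ

/-- The primes of `𝒫(n)`: `q ∈ 𝒫(n) ↔ q ∈ 𝒫 ∧ q ∉ n`. [cite: MazurRubin2004, Example 3.1.12 (p. 22)] -/
@[simp] theorem mem_awayFrom_primes_iff (D : KolyvaginDatum ρ) (n : Finset (HeightOneSpectrum (𝓞 K)))
    (q : HeightOneSpectrum (𝓞 K)) : q ∈ (D.awayFrom n).primes ↔ q ∈ D.primes ∧ q ∉ n := by
  simp [awayFrom]

/-- Levels of `𝒫(n)` are the levels of `𝒫` disjoint from `n` ("`m ∈ 𝒩` prime to `n`").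
[cite: MazurRubin2004, Example 3.1.12 (p. 22)] -/
theorem isLevel_awayFrom_iff (D : KolyvaginDatum ρ) (n m : Finset (HeightOneSpectrum (𝓞 K))) :
    (D.awayFrom n).IsLevel m ↔ D.IsLevel m ∧ Disjoint n m := by
  rw [awayFrom, isLevel_restrictPrimes_iff, Set.subset_compl_iff_disjoint_left, Finset.disjoint_coe]

/-- The level structures of `𝒫(n)` are those of `𝒫`. [cite: MazurRubin2004, Example 3.1.12 (p. 22)] -/
@[simp] theorem atLevel_awayFrom (D : KolyvaginDatum ρ) (n : Finset (HeightOneSpectrum (𝓞 K)))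
    (𝓕 : SelmerStructure ρ) (m : Finset (HeightOneSpectrum (𝓞 K))) :
    (D.awayFrom n).atLevel 𝓕 m = D.atLevel 𝓕 m := rfl

/-- **The shifted collection `κ^{(n)}`**: `κ^{(n)}_m := κ_{nm}` for `m` disjoint from `n` (Mazur–Rubin
Example 3.1.12, "`κ^{(n)}_m = κ_{nm} ⊗ ξ` for `m ∈ 𝒩` prime to `n`"; the factor `⊗ξ`, `ξ` a generator of
`Hom(G_n, R/I_n)`, is absorbed by the generator-fixed convention of `KolyvaginSystems.lean`), and `0`
on the finite sets meeting `n` (which are not levels of `𝒫(n)`).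
[cite: MazurRubin2004, Example 3.1.12 (p. 22)] [cite: Kim2022StructureSelmer, §2.2.2] -/
def shift (κ : Finset (HeightOneSpectrum (𝓞 K)) → galoisCohomology ρ 1)
    (n : Finset (HeightOneSpectrum (𝓞 K))) :
    Finset (HeightOneSpectrum (𝓞 K)) → galoisCohomology ρ 1 :=
  fun m => if Disjoint n m then κ (n ∪ m) else 0

omit [NumberField K] in
/-- `κ^{(n)}_m = κ_{n ∪ m}` for `m` disjoint from `n`. [cite: MazurRubin2004, Example 3.1.12 (p. 22)] -/
theorem shift_apply_of_disjoint (κ : Finset (HeightOneSpectrum (𝓞 K)) → galoisCohomology ρ 1)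
    {n m : Finset (HeightOneSpectrum (𝓞 K))} (h : Disjoint n m) : shift κ n m = κ (n ∪ m) := by
  simp [shift, h]

omit [NumberField K] in
/-- `κ^{(n)}_m = 0` for `m` meeting `n`. [cite: MazurRubin2004, Example 3.1.12 (p. 22)] -/
theorem shift_apply_of_not_disjoint (κ : Finset (HeightOneSpectrum (𝓞 K)) → galoisCohomology ρ 1)
    {n m : Finset (HeightOneSpectrum (𝓞 K))} (h : ¬ Disjoint n m) : shift κ n m = 0 := by
  simp [shift, h]

omit [NumberField K] in
/-- The shift by a single prime: `κ^{(ℓ)}_m = κ_{mℓ}` for `ℓ ∉ m` (the case used in the proof of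
Prop. 4.5.8). [cite: MazurRubin2004, Example 3.1.12 (p. 22) and proof of Prop. 4.5.8 (p. 50)] -/
theorem shift_singleton_apply (κ : Finset (HeightOneSpectrum (𝓞 K)) → galoisCohomology ρ 1)
    {q : HeightOneSpectrum (𝓞 K)} {m : Finset (HeightOneSpectrum (𝓞 K))} (h : q ∉ m) :
    shift κ {q} m = κ (insert q m) := by
  rw [shift_apply_of_disjoint κ (Finset.disjoint_singleton_left.mpr h), Finset.insert_eq]

/-- **Example 3.1.12: `κ^{(n)}` is a Kolyvagin system for `(T, 𝓕(n), 𝒫(n))`** ("If `ξ ∈ Hom(G_n, R/I_n)`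
then the collection `κ^{(n)}` defined by `κ^{(n)}_m = κ_{nm} ⊗ ξ` for `m ∈ 𝒩` prime to `n` is a Kolyvagin
system for `(T/I_nT, 𝓕(n), 𝒫(n))`"; here at finite level, `I_n = 0`).  PROVED: the Selmer condition
is `κ_{nm} ∈ H¹_{𝓕(nm)}` with `𝓕(nm) = (𝓕(n))(m)` (`transverseAt_transverseAt`), and the
finite–singular relation at `𝔮 ∈ 𝒫(n)`, `𝔮 ∉ m`, is that of `κ` at the level `nm` and the prime `𝔮`.
[cite: MazurRubin2004, Example 3.1.12 (pp. 22–23)] -/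
theorem IsKolyvaginSystem.shift {D : KolyvaginDatum ρ} {𝓕 : SelmerStructure ρ}
    {κ : Finset (HeightOneSpectrum (𝓞 K)) → galoisCohomology ρ 1} (hκ : D.IsKolyvaginSystem 𝓕 κ)
    {n : Finset (HeightOneSpectrum (𝓞 K))} (hn : D.IsLevel n) :
    (D.awayFrom n).IsKolyvaginSystem (D.atLevel 𝓕 n) (shift κ n) where
  eq_zero_of_not_isLevel m hm := by
    by_cases h : Disjoint n m
    · rw [shift_apply_of_disjoint κ h]
      refine hκ.eq_zero_of_not_isLevel _ fun hnm => hm ?_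
      exact (D.isLevel_awayFrom_iff n m).mpr
        ⟨fun q hq => hnm (Finset.mem_union_right n hq), h⟩
    · exact shift_apply_of_not_disjoint κ h
  mem_selmerGroup m hm := by
    obtain ⟨hm', hdisj⟩ := (D.isLevel_awayFrom_iff n m).mp hm
    rw [shift_apply_of_disjoint κ hdisj, atLevel_awayFrom, KolyvaginDatum.atLevel,
      SelmerStructure.transverseAt_transverseAt]
    exact hκ.mem_selmerGroup (n ∪ m) (fun q hq => (Finset.mem_union.mp hq).elim (fun h => hn h)
      fun h => hm' h)
  fs_rel m hm q hq hqm := by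
    obtain ⟨hm', hdisj⟩ := (D.isLevel_awayFrom_iff n m).mp hm
    obtain ⟨hqP, hqn⟩ := (D.mem_awayFrom_primes_iff n q).mp hq
    have hdisj' : Disjoint n (insert q m) := by
      rw [Finset.disjoint_insert_right]; exact ⟨hqn, hdisj⟩
    have hnm : D.IsLevel (n ∪ m) := fun x hx =>
      (Finset.mem_union.mp hx).elim (fun h => hn h) fun h => hm' h
    have hq' : q ∉ n ∪ m := by simp [hqn, hqm]
    rw [shift_apply_of_disjoint κ hdisj', shift_apply_of_disjoint κ hdisj,
      Finset.union_insert]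
    exact hκ.fs_rel (n ∪ m) hnm q hqP hq'

/-- The shifted system lies in `KS₁(T, 𝓕(n))` for the datum away from `n` ("This construction
defines a homomorphism `KS(T,𝓕,𝒫) ⊗ Hom(G_n, R/I_n) → KS(T/I_nT, 𝓕(n), 𝒫(n))`").
[cite: MazurRubin2004, Example 3.1.12 (p. 23)] -/
theorem shift_mem_kolyvaginSystems {D : KolyvaginDatum ρ} {𝓕 : SelmerStructure ρ}
    (κ : D.kolyvaginSystems 𝓕) {n : Finset (HeightOneSpectrum (𝓞 K))} (hn : D.IsLevel n) :
    shift κ.1 n ∈ (D.awayFrom n).kolyvaginSystems (D.atLevel 𝓕 n) :=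
  ((D.mem_kolyvaginSystems_iff 𝓕 κ.1).mp κ.2).shift hn

/-! ## D. The inequality of the proof of Prop. 4.5.8: `∂^{(r+1)}(κ) ≤ ∂^{(r)}(κ^{(ℓ)})` -/

/-- **`∂^{(r+1)}(κ) ≤ ∂^{(r)}(κ^{(ℓ)})`** for a Kolyvagin prime `ℓ ∈ 𝒫` (proof of Mazur–Rubin
Prop. 4.5.8, p. 50, "clear from the definition"; printed there with the inequality sign reversed, see
the module docstring): every level `m` of `𝒫 − {ℓ}` with `ν(m) = r` gives the level `mℓ` of `𝒫` with
`ν(mℓ) = r + 1` and the same term `k − length(Rκ_{mℓ}) = k − length(Rκ^{(ℓ)}_m)`, so the minimum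
defining `∂^{(r+1)}(κ)` runs over a superset of terms.  PROVED; valid for any function `κ` on levels.
[cite: MazurRubin2004, Def. 4.5.7 (p. 49) and proof of Prop. 4.5.8 (p. 50)] -/
theorem kolyvaginPartial_le_kolyvaginPartial_shift (D : KolyvaginDatum ρ) (p k : ℕ)
    (κ : Finset (HeightOneSpectrum (𝓞 K)) → galoisCohomology ρ 1)
    {q : HeightOneSpectrum (𝓞 K)} (hq : q ∈ D.primes) (r : ℕ) :
    D.kolyvaginPartial p k κ (r + 1) ≤ (D.awayFrom {q}).kolyvaginPartial p k (shift κ {q}) r := by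
  refine le_iInf fun m => le_iInf fun hm => le_iInf fun hr => ?_
  obtain ⟨hm', hdisj⟩ := (D.isLevel_awayFrom_iff {q} m).mp hm
  have hqm : q ∉ m := Finset.disjoint_singleton_left.mp hdisj
  rw [shift_singleton_apply κ hqm]
  exact D.kolyvaginPartial_le p k κ (hm'.insert hq) (by rw [Finset.card_insert_of_notMem hqm, hr])

/-- `∂^{(∞)}(κ) ≤ ∂^{(∞)}(κ^{(ℓ)})` for `ℓ ∈ 𝒫` (minimise the previous inequality over `r`).
[cite: MazurRubin2004, Def. 5.2.11 (p. 58) with the proof of Prop. 4.5.8 (p. 50)] -/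
theorem kolyvaginPartialInfty_le_kolyvaginPartialInfty_shift (D : KolyvaginDatum ρ) (p k : ℕ)
    (κ : Finset (HeightOneSpectrum (𝓞 K)) → galoisCohomology ρ 1)
    {q : HeightOneSpectrum (𝓞 K)} (hq : q ∈ D.primes) :
    D.kolyvaginPartialInfty p k κ ≤ (D.awayFrom {q}).kolyvaginPartialInfty p k (shift κ {q}) :=
  le_iInf fun r =>
    (D.kolyvaginPartialInfty_le p k κ (r + 1)).trans
      (D.kolyvaginPartial_le_kolyvaginPartial_shift p k κ hq r)

end KolyvaginDatum

end Literature.NumberTheory.GaloisCohomology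

end
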